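import Mathlib
import HarnessLib
import Literature.RingTheory.TightClosure.TightClosure

/-!
# Route FrobeniusLadder — crux `FInjectiveMacaulayfication` (stmt-ResolutionOfSingularities-15315), line `Sketch`, stub `stub_parameter_blowup_not_frobenius_closed`

The NO-GO WITNESS of card `weakly-normal-centres`: blowing up a PARAMETER ideal never
F-injectivizes. On the chart `y = xT` of `Bl_{(x,y)} E₈⁰` one gets
`A = k[x,T,z]/(z² + x³ + x⁵T⁵)` (variables `X 0 = x`, `X 1 = T`, `X 2 = z`), and for every prime
`p` and every field `k` of characteristic `p`:

* the class `u₂` of `z` is **not** in the height-one parameter ideal `(u₀)` (class of `x`): the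
  `k`-algebra map `k[X₀,X₁,X₂] → k[ε]/(ε²)` (dual numbers), `X₂ ↦ ε`, `X₀, X₁ ↦ 0`, kills
  `f = X₂² + X₀³ + X₀⁵X₁⁵` (as `ε² = 0`), hence factors through `A`; it kills `u₀` but sends `u₂` to
  `ε ≠ 0`;
* `u₂^p ∈ (u₀^p)`: for `p = 2`, `u₂² = -(u₀ + u₀³u₁⁵) · u₀²`; for odd `p = 2(n+1)+1`,
  `u₂^p = u₂ · (u₂²)^(n+1) = u₂ · (u₀³ · w)^(n+1) = (u₂ · u₀^n · w^(n+1)) · u₀^p` with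
  `w = -(1 + u₀²u₁⁵)`.

Together with the reading lemma `frobenius_closed_principal_gives_pth_root_closed` (Quy–Shimomoto,
arXiv:1601.02524, Rem. 3.10 with `e = 1`) this says: the parameter ideal `(x)` of the chart is not
Frobenius closed. Pure commutative algebra over Mathlib (`MvPolynomial`, `Ideal.Quotient`,
`DualNumber`); the `CharP` hypothesis is carried by the registered signature but not used by the
algebra. Deliberately NOT here: the scheme-level statement about the blow-up (the chart computation
is done by hand in the card).
-/

-- single-problem summit: the doubled namespace component is forced
set_option linter.dupNamespace false

namespace Summit.ResolutionOfSingularities.ResolutionOfSingularities.Theorems.FInjectiveMacaulayfication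

open MvPolynomial

/-- NO-GO WITNESS (card `weakly-normal-centres`, line `Sketch`, stub
`stub_parameter_blowup_not_frobenius_closed` of crux stmt-ResolutionOfSingularities-15315): in
`A = k[X₀,X₁,X₂]/(f)`, `f = X₂² + X₀³ + X₀⁵X₁⁵`, `char k = p` prime, the class of `X₂` is not in
the principal ideal generated by the class of `X₀`, although its `p`-th power lies in the ideal
generated by the `p`-th power of the class of `X₀`. Proof: non-membership by evaluation
`X₂ ↦ ε`, `X₀, X₁ ↦ 0` into the dual numbers `k[ε]` (it factors through `A`, kills the class of
`X₀`, and sends the class of `X₂` to `ε ≠ 0`); membership by the explicit cofactor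
`-(u₀ + u₀³u₁⁵)` for `p = 2` and `u₂ · u₀^n · (-(1 + u₀²u₁⁵))^(n+1)` for `p = 2(n+1)+1`, using the
relation `u₂² = -(u₀³ + u₀⁵u₁⁵)` in `A`. -/
theorem stub_parameter_blowup_not_frobenius_closed : ∀ (p : ℕ), p.Prime → ∀ (k : Type) [Field k] [CharP k p]
    (f : MvPolynomial (Fin 3) k),
    f = MvPolynomial.X 2 ^ 2 + MvPolynomial.X 0 ^ 3 + MvPolynomial.X 0 ^ 5 * MvPolynomial.X 1 ^ 5 →
      Ideal.Quotient.mk (Ideal.span {f}) (MvPolynomial.X 2) ∉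
          Ideal.span {Ideal.Quotient.mk (Ideal.span {f}) (MvPolynomial.X 0)} ∧
        Ideal.Quotient.mk (Ideal.span {f}) (MvPolynomial.X 2) ^ p ∈
          Ideal.span {Ideal.Quotient.mk (Ideal.span {f}) (MvPolynomial.X 0) ^ p} := by
  intro p hp k _ _ f hf
  -- the defining relation of `A = k[X₀,X₁,X₂]/(f)`
  have hrel : Ideal.Quotient.mk (Ideal.span {f}) (X 2) ^ 2
      + Ideal.Quotient.mk (Ideal.span {f}) (X 0) ^ 3
      + Ideal.Quotient.mk (Ideal.span {f}) (X 0) ^ 5 * Ideal.Quotient.mk (Ideal.span {f}) (X 1) ^ 5 = 0 := by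
    have h : Ideal.Quotient.mk (Ideal.span {f}) (X 2 ^ 2 + X 0 ^ 3 + X 0 ^ 5 * X 1 ^ 5) = 0 := by
      rw [← hf]
      exact Ideal.Quotient.eq_zero_iff_mem.mpr (Ideal.mem_span_singleton_self f)
    simpa only [map_add, map_mul, map_pow] using h
  refine ⟨?_, ?_⟩
  · -- the class of `X 2` is not in `(class of X 0)`: evaluate into the dual numbers `k[ε]`
    intro h2
    set v : Fin 3 → DualNumber k := Pi.single 2 DualNumber.eps with hv
    have hvf : (MvPolynomial.aeval v).toRingHom f = 0 := by
      rw [hf]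
      simp [hv]
    have hker : ∀ a ∈ Ideal.span {f}, (MvPolynomial.aeval v).toRingHom a = 0 := by
      intro a ha
      obtain ⟨c, rfl⟩ := Ideal.mem_span_singleton'.mp ha
      rw [map_mul, hvf, mul_zero]
    obtain ⟨θ, hθ⟩ :
        ∃ θ : MvPolynomial (Fin 3) k ⧸ Ideal.span {f} →+* DualNumber k,
          ∀ i, θ (Ideal.Quotient.mk (Ideal.span {f}) (X i)) = v i :=
      ⟨Ideal.Quotient.lift (Ideal.span {f}) (MvPolynomial.aeval v).toRingHom hker, fun i => by
        rw [Ideal.Quotient.lift_mk]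
        exact MvPolynomial.aeval_X v i⟩
    obtain ⟨c, hc⟩ := Ideal.mem_span_singleton'.mp h2
    have h0 := congrArg θ hc
    rw [map_mul, hθ, hθ, hv, Pi.single_eq_same, Pi.single_eq_of_ne (by decide), mul_zero] at h0
    have h1 := congrArg TrivSqZeroExt.snd h0
    simp at h1
  · -- the `p`-th power of the class of `X 2` lies in `((class of X 0) ^ p)`
    set u0 := Ideal.Quotient.mk (Ideal.span {f}) (X 0) with hu0
    set u1 := Ideal.Quotient.mk (Ideal.span {f}) (X 1) with hu1
    set u2 := Ideal.Quotient.mk (Ideal.span {f}) (X 2) with hu2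
    rcases hp.eq_two_or_odd' with rfl | hodd
    · -- `p = 2`: `u₂² = -(u₀ + u₀³u₁⁵) · u₀²`
      refine Ideal.mem_span_singleton'.mpr ⟨-(u0 + u0 ^ 3 * u1 ^ 5), ?_⟩
      linear_combination (-1 : MvPolynomial (Fin 3) k ⧸ Ideal.span {f}) * hrel
    · -- `p = 2m+1` odd, `m = n+1 ≥ 1`
      obtain ⟨m, rfl⟩ := hodd
      obtain ⟨n, rfl⟩ : ∃ n, m = n + 1 := ⟨m - 1, by have := hp.two_le; omega⟩
      have h3 : u2 ^ 2 = u0 ^ 3 * -(1 + u0 ^ 2 * u1 ^ 5) := by linear_combination hrel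
      refine Ideal.mem_span_singleton'.mpr ⟨u2 * u0 ^ n * (-(1 + u0 ^ 2 * u1 ^ 5)) ^ (n + 1), ?_⟩
      rw [show u2 ^ (2 * (n + 1) + 1) = u2 * (u2 ^ 2) ^ (n + 1) by ring, h3, mul_pow]
      ring

/-- READING LEMMA (card `weakly-normal-centres`): if the principal ideal `(x)` is Frobenius closed then
`a^p ∈ (x^p) ⇒ a ∈ (x)` (Quy–Shimomoto arXiv:1601.02524 Rem. 3.10: `(x^p) ⊆ (x)^{[p]}`, take `e = 1`). With
`stub_parameter_blowup_not_frobenius_closed` it shows that the height-one parameter ideal `(x)` of the chart is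
not Frobenius closed. -/
theorem frobenius_closed_principal_gives_pth_root_closed {R : Type} [CommRing R] (p : ℕ) [ExpChar R p]
    (x a : R) (hx : Literature.RingTheory.TightClosure.IsFrobeniusClosed p (Ideal.span {x}))
    (ha : a ^ p ∈ Ideal.span {x ^ p}) : a ∈ Ideal.span {x} := by
  rw [Literature.RingTheory.TightClosure.isFrobeniusClosed_iff] at hx
  refine hx a ⟨1, ?_⟩
  rw [pow_one]
  refine Ideal.span_mono ?_ ha
  rintro _ rfl
  exact ⟨x, Ideal.mem_span_singleton_self x, rfl⟩

end Summit.ResolutionOfSingularities.ResolutionOfSingularities.Theorems.FInjectiveMacaulayfication
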